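import Summits.QuantumFields.BalabanUV.Beta.D1BFx.RProjectorJet

/-!
# `BalabanUV.Beta.D1BFx.RProjectorJetLeibniz` — road «BF-x» for binder row D1, leaf J5 (KERNEL LEVEL, part 2): THE TYPED SITE JET `Ṙ_s`
# PASSES THE PROJECTOR-LEIBNIZ SOCKET ON `ℤ⁴` — `P∘Ṙ_s + Ṙ_s∘P = Ṙ_s` (equivalently `R∘Ṙ_s + Ṙ_s∘R = Ṙ_s`, `R∘Ṙ_s∘R = 0 = P∘Ṙ_s∘P`), generically
# from `P∘P = P`, `Pᵀ = P`, `J∘P = J`, and for the instance over leaf-09-g2's projector (`tsum_Pgt_mul_Pgt`, `Pgt_symm`, and the new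
# lattice identity `Σ'_r (G′Q′*C)(r,y)·P(r,q) = (G′Q′*C)(q,y)`, i.e. `X⁺∘P = X⁺`)

HONEST DEPENDENCY (page 1, mandatory): continuum YM on T⁴ ⇐ BetaPertH ∧ nine spine estimates (0/9 proved); BetaPertH ⇐ (D1) ∧ (D4) ∧
CAP+tail; G-an2-4 gates asym, D1 and NE2/3/4.  HONEST FRAMING: discharging `BetaPertH` makes Bałaban's UV stability UNCONDITIONAL — NOT
the continuum limit and NOT the Clay problem.  THIS FILE DISCHARGES NOTHING of the wall: [folklore] algebra of absolutely convergent
lattice-kernel compositions (`TameKernelCalculus.comp_assoc_tame`, `comp_sub_*_tame`, `trK_comp`) and ONE Fubini exchange on `ℤ^d × ℤ^d`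
under an exponential majorant (`B5Hk103ScalarZd.tsum_mul_tsum_comm`, `tsum_blocks`, leaf-09-g2's `RProjectorRange.tsum_gq_mul_Pker` /
`abs_sum_B_Pker_mul_gq_le` BY NAME); 0 binders of row D1 touched; no `def … : Prop`, no cited hypothesis.

WHY (`D1BFx/ProjectorJetStripped.eq_cojetSkew_iff`, p211963: a skew `Z` IS the stripped jet of the coprojector `R = 1 − P` along the
column variation `Ẋ` iff `R·Z + Z·R = Z` and `Z·X + R·Ẋ = 0`).  Part 1 (`D1BFx/RProjectorJet`, p212207) TYPED the candidate
`Rdot n a cK cQ κ′ u = rdotOf (Ggh n a) (Pgt n a) (Sgh n cK cQ κ′ u) (Jq n a κ′ u)` and proved it skew.  This file proves the FIRST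
recognition identity ON THE LATTICE:
* §1 [folklore] generic: for `Spr G`, `Spr P`, `Loc V`, `Loc J` with `comp P P = P`, `trK P = P`, `comp J P = J`:
  `comp P (cornerV G P V) = 0`, `comp (cornerV G P V) P = cornerV G P V` (likewise `cornerJ`), hence
  **`comp P (rdotOf G P V J) + comp (rdotOf G P V J) P = rdotOf G P V J`** (`leibniz_P`), the `R = idK − P` form (`leibniz_R`), and the
  off-diagonality `comp (comp P Z) P = 0`, `comp (comp R Z) R = 0`.
* §2 [folklore] the lattice identity **`tsum_kerP_mul_Pker`**: `Σ'_r kerP m a r y · Pker m a r q = kerP m a q y` (`X⁺·P = X⁺` read through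
  `RProjector`'s normalisation `X⁺(y,q) = (m+1)^{−d}·kerP q y`; one Fubini, block by block) ⇒ **`comp_Jq_Pgt : comp (Jq n a κ′ u) (Pgt n a) = Jq n a κ′ u`**;
  `comp_Pgt_Pgt`, `trK_Pgt` (from `tsum_Pgt_mul_Pgt`, `Pgt_symm` BY NAME).
* §3 [folklore] THE INSTANCE: **`leibniz_P_Rdot`** / **`leibniz_R_Rdot`** / `Pgt_Rdot_Pgt` / `R_Rdot_R` for `Rdot n a cK cQ κ′ u`, GIVEN the fine
  `ℓ¹` decay of `Pgt n a` (binder `hP : Decays (Pgt n a) CP δP`, `0 < δP` — leaf-05-g3's `decays_Pgt`; needed only for the absolute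
  convergence bookkeeping `Spr (Pgt n a)`).
NOT HERE (part 3 / successor): the SECOND recognition identity `Ṙ_s∘X + R∘Ẋ_s = 0` (needs `X⁺∘X = 1` on the lattice:
`RProjectorRange.tsum_bb_eq_kerSq` + `tsum_Csq_mul_kerSq`, one more Fubini).  Unit `b2b-balaban-beta-d1-formalise-leaf-07` (gen 2).
-/

namespace Summit.QuantumFields.BalabanUV.Beta.D1BFx.RProjectorJetLeibniz

open Literature.MathematicalPhysics.QuantumFieldTheory.Balaban1983to89
open Literature.MathematicalPhysics.QuantumFieldTheory.Balaban1983to89.Beta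
open B4Sect5Proof (latticeConst latticeConst_nonneg)
open B6QGQLower276 (X B blk mem_B)
open B6QGQDecay237 (cU deltaU cU_pos deltaU_pos)
open B5Hk103ScalarZd (gq abs_gq_le tsum_mul_tsum_comm tsum_blocks)
open B6QGGQ278Zd (Csq cC cC_pos deltaC deltaC_pos abs_Csq_le)
open ExpKernelCalculus (Site MKer Decays BiLoc comp)
open HessKerSchurResolvent (idK comp_idK_left comp_idK_right)
open BalabanStepJetsSucc (decays_comp)
open Summit.QuantumFields.BalabanUV.Beta.TameKernelCalculus (trK trK_apply trK_trK trK_sub trK_neg trK_comp Spr Loc Tame Spr.tame Loc.tame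
  Spr.comp_loc Loc.comp_spr Loc.trK Loc.sub spr_idK comp_assoc_tame comp_sub_left_tame comp_sub_right_tame comp_add_left_tame
  comp_add_right_tame decays_of_le)
open GhostLeg (Ggh spr_Ggh)
open GhostStencil (qJet Sgh biLoc_Sgh)
open RProjector (kerP Pker Pgt Pgt_apply Pgt_symm Pker_symm cP deltaP cP_nonneg deltaP_pos cPP deltaPP cPP_nonneg deltaPP_pos abs_kerP_le
  abs_Pker_le summable_kerP sum_mul_kerP Csq_symm)
open RProjectorRange (tsum_Pgt_mul_Pgt tsum_gq_mul_Pker abs_sum_B_Pker_mul_gq_le summable_of_blk_majorant summable_gq_mul_Pker)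
open RProjectorJet (RG cornerV cornerJ rdotOf Jq Jq_apply Rdot biLoc_Jq dR dR_pos decays_sub')

noncomputable section

/-! ## §1 The generic Leibniz identity -/

section Generic

variable {G P V J : MKer 4 Unit}

/-- [folklore] `0 ∘ K = 0`. -/
theorem zero_comp (K : MKer 4 Unit) : comp (0 : MKer 4 Unit) K = 0 := by
  funext x z a b; simp [comp]

/-- [folklore] `K ∘ 0 = 0`. -/
theorem comp_zero (K : MKer 4 Unit) : comp K (0 : MKer 4 Unit) = 0 := by
  funext x z a b; simp [comp]

/-- [folklore] `trK 0 = 0`. -/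
theorem trK_zero : trK (0 : MKer 4 Unit) = 0 := rfl

/-- [folklore] Spread kernels are closed under subtraction. -/
theorem spr_sub {A B : MKer 4 Unit} (hA : Spr A) (hB : Spr B) : Spr (A - B) := by
  obtain ⟨CA, δA, hδA, hA⟩ := hA
  obtain ⟨CB, δB, hδB, hB⟩ := hB
  refine ⟨|CA| + |CB|, min δA δB, lt_min hδA hδB, ?_⟩
  exact decays_sub' (decays_of_le hA (min_le_left _ _)) (decays_of_le hB (min_le_right _ _))

/-- [folklore] Spread kernels are closed under composition (`BalabanStepJetsSucc.decays_comp` at the common rate). -/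
theorem spr_comp {A B : MKer 4 Unit} (hA : Spr A) (hB : Spr B) : Spr (comp A B) := by
  obtain ⟨CA, δA, hδA, hA⟩ := hA
  obtain ⟨CB, δB, hδB, hB⟩ := hB
  have hδ : 0 < min δA δB := lt_min hδA hδB
  exact ⟨_, min δA δB / 2, by positivity,
    decays_comp (decays_of_le hA (min_le_left _ _)) (decays_of_le hB (min_le_right _ _)) (by positivity) (by linarith)⟩

/-- [folklore] `R∘G′` is spread. -/
theorem spr_RG (hG : Spr G) (hP : Spr P) : Spr (RG G P) := spr_sub hG (spr_comp hP hG)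

/-- [folklore] The `V`-corner is localised. -/
theorem loc_cornerV (hG : Spr G) (hP : Spr P) (hV : Loc V) : Loc (cornerV G P V) :=
  ((spr_RG hG hP).comp_loc hV).comp_spr hP

/-- [folklore] The `Q̇`-corner is localised. -/
theorem loc_cornerJ (hG : Spr G) (hP : Spr P) (hJ : Loc J) : Loc (cornerJ G P J) := (spr_RG hG hP).comp_loc hJ

/-- [folklore] **`P∘(R∘G′) = 0`** from `P∘P = P`. -/
theorem comp_P_RG (hG : Spr G) (hP : Spr P) (hPP : comp P P = P) : comp P (RG G P) = 0 := by
  rw [RG, comp_sub_right_tame hP.tame hG.tame (spr_comp hP hG).tame, comp_assoc_tame hP.tame hP.tame hG.tame, hPP, sub_self]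

/-- [folklore] `P ∘ cornerV = 0`. -/
theorem comp_P_cornerV (hG : Spr G) (hP : Spr P) (hV : Loc V) (hPP : comp P P = P) : comp P (cornerV G P V) = 0 := by
  rw [cornerV, comp_assoc_tame hP.tame ((spr_RG hG hP).comp_loc hV).tame hP.tame,
    comp_assoc_tame hP.tame (spr_RG hG hP).tame hV.tame, comp_P_RG hG hP hPP, zero_comp, zero_comp]

/-- [folklore] `cornerV ∘ P = cornerV` from `P∘P = P`. -/
theorem cornerV_comp_P (hG : Spr G) (hP : Spr P) (hV : Loc V) (hPP : comp P P = P) : comp (cornerV G P V) P = cornerV G P V := by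
  rw [cornerV, ← comp_assoc_tame ((spr_RG hG hP).comp_loc hV).tame hP.tame hP.tame, hPP]

/-- [folklore] `P ∘ cornerJ = 0`. -/
theorem comp_P_cornerJ (hG : Spr G) (hP : Spr P) (hJ : Loc J) (hPP : comp P P = P) : comp P (cornerJ G P J) = 0 := by
  rw [cornerJ, comp_assoc_tame hP.tame (spr_RG hG hP).tame hJ.tame, comp_P_RG hG hP hPP, zero_comp]

/-- [folklore] `cornerJ ∘ P = cornerJ` from `J∘P = J`. -/
theorem cornerJ_comp_P (hG : Spr G) (hP : Spr P) (hJ : Loc J) (hJP : comp J P = J) : comp (cornerJ G P J) P = cornerJ G P J := by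
  rw [cornerJ, ← comp_assoc_tame (spr_RG hG hP).tame hJ.tame hP.tame, hJP]

/-- [folklore] Transposed corners, left: `P ∘ Cᵀ = (C ∘ P)ᵀ`, so `= Cᵀ` when `C∘P = C` (`Pᵀ = P`). -/
theorem comp_P_trK {C : MKer 4 Unit} (hPsym : trK P = P) (hCP : comp C P = C) : comp P (trK C) = trK C := by
  rw [← hPsym, ← trK_comp, hCP]

/-- [folklore] Transposed corners, right: `Cᵀ ∘ P = (P ∘ C)ᵀ`, so `= 0` when `P∘C = 0`. -/
theorem trK_comp_P {C : MKer 4 Unit} (hPsym : trK P = P) (hPC : comp P C = 0) : comp (trK C) P = 0 := by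
  rw [← hPsym, ← trK_comp, hPC, trK_zero]

/-- [folklore] **THE GENERIC LEIBNIZ IDENTITY, `P`-FORM**: `Spr G`, `Spr P`, `Loc V`, `Loc J`, `P∘P = P`, `Pᵀ = P`, `J∘P = J` ⟹
`P ∘ Ṙ + Ṙ ∘ P = Ṙ` for `Ṙ = rdotOf G P V J`. -/
theorem leibniz_P (hG : Spr G) (hP : Spr P) (hV : Loc V) (hJ : Loc J) (hPP : comp P P = P) (hPsym : trK P = P)
    (hJP : comp J P = J) : comp P (rdotOf G P V J) + comp (rdotOf G P V J) P = rdotOf G P V J := by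
  have hCV := loc_cornerV hG hP hV
  have hCJ := loc_cornerJ hG hP hJ
  have h1 := comp_P_cornerV hG hP hV hPP
  have h2 := cornerV_comp_P hG hP hV hPP
  have h3 := comp_P_cornerJ hG hP hJ hPP
  have h4 := cornerJ_comp_P hG hP hJ hJP
  have h5 : comp P (trK (cornerV G P V)) = trK (cornerV G P V) := comp_P_trK hPsym h2
  have h6 : comp (trK (cornerV G P V)) P = 0 := trK_comp_P hPsym h1
  have h7 : comp P (trK (cornerJ G P J)) = trK (cornerJ G P J) := comp_P_trK hPsym h4
  have h8 : comp (trK (cornerJ G P J)) P = 0 := trK_comp_P hPsym h3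
  have tP := hP.tame
  have tV : Tame (cornerV G P V - trK (cornerV G P V)) := (hCV.sub hCV.trK).tame
  have tJ : Tame (cornerJ G P J - trK (cornerJ G P J)) := (hCJ.sub hCJ.trK).tame
  rw [rdotOf, comp_sub_right_tame tP tV tJ, comp_sub_right_tame tP hCV.tame hCV.trK.tame, comp_sub_right_tame tP hCJ.tame hCJ.trK.tame,
    comp_sub_left_tame tV tJ tP, comp_sub_left_tame hCV.tame hCV.trK.tame tP, comp_sub_left_tame hCJ.tame hCJ.trK.tame tP,
    h1, h2, h3, h4, h5, h6, h7, h8]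
  abel

/-- [folklore] The generic jet is localised (hence tame). -/
theorem loc_rdotOf (hG : Spr G) (hP : Spr P) (hV : Loc V) (hJ : Loc J) : Loc (rdotOf G P V J) :=
  ((loc_cornerV hG hP hV).sub (loc_cornerV hG hP hV).trK).sub ((loc_cornerJ hG hP hJ).sub (loc_cornerJ hG hP hJ).trK)

/-- [folklore] **OFF-DIAGONALITY, `P`-corner**: `(P ∘ Ṙ) ∘ P = 0` (multiply `leibniz_P` by `P` on the left and use `P∘P = P`). -/
theorem P_rdot_P (hG : Spr G) (hP : Spr P) (hV : Loc V) (hJ : Loc J) (hPP : comp P P = P) (hPsym : trK P = P)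
    (hJP : comp J P = J) : comp (comp P (rdotOf G P V J)) P = 0 := by
  have hZ := loc_rdotOf hG hP hV hJ
  have tP := hP.tame
  have tZ := hZ.tame
  have h := congrArg (comp P) (leibniz_P hG hP hV hJ hPP hPsym hJP)
  rw [comp_add_right_tame tP (hP.comp_loc hZ).tame (hZ.comp_spr hP).tame, comp_assoc_tame tP tP tZ, hPP,
    comp_assoc_tame tP tZ tP] at h
  -- h : comp P Z + comp (comp P Z) P = comp P Z
  have := add_eq_left.mp h
  exact this

/-- [folklore] **THE GENERIC LEIBNIZ IDENTITY, `R`-FORM**: with `R := idK − P`, `R ∘ Ṙ + Ṙ ∘ R = Ṙ`. -/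
theorem leibniz_R (hG : Spr G) (hP : Spr P) (hV : Loc V) (hJ : Loc J) (hPP : comp P P = P) (hPsym : trK P = P)
    (hJP : comp J P = J) :
    comp (idK - P) (rdotOf G P V J) + comp (rdotOf G P V J) (idK - P) = rdotOf G P V J := by
  have hZ := loc_rdotOf hG hP hV hJ
  have tP := hP.tame
  have tZ := hZ.tame
  have tI : Tame (idK : MKer 4 Unit) := spr_idK.tame
  have h := leibniz_P hG hP hV hJ hPP hPsym hJP
  rw [comp_sub_left_tame tI tP tZ, comp_sub_right_tame tZ tI tP, comp_idK_left, comp_idK_right]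
  -- (Z - PZ) + (Z - ZP) = Z  ⟸  PZ + ZP = Z
  have e : rdotOf G P V J - comp P (rdotOf G P V J) + (rdotOf G P V J - comp (rdotOf G P V J) P) =
      rdotOf G P V J + rdotOf G P V J - (comp P (rdotOf G P V J) + comp (rdotOf G P V J) P) := by abel
  rw [e, h]
  abel

/-- [folklore] **OFF-DIAGONALITY, `R`-corner**: `(R ∘ Ṙ) ∘ R = 0`, `R = idK − P`. -/
theorem R_rdot_R (hG : Spr G) (hP : Spr P) (hV : Loc V) (hJ : Loc J) (hPP : comp P P = P) (hPsym : trK P = P)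
    (hJP : comp J P = J) : comp (comp (idK - P) (rdotOf G P V J)) (idK - P) = 0 := by
  have hZ := loc_rdotOf hG hP hV hJ
  have tP := hP.tame
  have tZ := hZ.tame
  have tI : Tame (idK : MKer 4 Unit) := spr_idK.tame
  have h := leibniz_P hG hP hV hJ hPP hPsym hJP
  have h2 := P_rdot_P hG hP hV hJ hPP hPsym hJP
  have tPZ : Tame (comp P (rdotOf G P V J)) := (hP.comp_loc hZ).tame
  have tRZ : Tame (rdotOf G P V J - comp P (rdotOf G P V J)) := (hZ.sub (hP.comp_loc hZ)).tame
  rw [comp_sub_left_tame tI tP tZ, comp_idK_left, comp_sub_right_tame tRZ tI tP, comp_idK_right, comp_sub_left_tame tZ tPZ tP, h2,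
    sub_zero]
  -- Z - PZ - ZP = 0
  have e : rdotOf G P V J - comp P (rdotOf G P V J) - comp (rdotOf G P V J) P =
      rdotOf G P V J - (comp P (rdotOf G P V J) + comp (rdotOf G P V J) P) := by abel
  rw [e, h, sub_self]

end Generic

/-! ## §2 The lattice identity `X⁺ ∘ P = X⁺` and the instance's three inputs -/

section Lattice

variable {d : ℕ}

/-- [folklore] `|P(r,q)| ≤ c_PP` (the exponential factor is `≤ 1`). -/
theorem abs_Pker_le_const (m : ℕ) {a : ℝ} (ha : 0 < a) (r q : X d) : |Pker m a r q| ≤ cPP d m a := by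
  refine (abs_Pker_le m ha r q).trans ?_
  have he : Real.exp (-(deltaPP d a * dist (blk m r) (blk m q))) ≤ 1 := by
    rw [Real.exp_le_one_iff, neg_nonpos]; exact mul_nonneg (deltaPP_pos d ha).le dist_nonneg
  have h0 := cPP_nonneg d m ha
  nlinarith

/-- [folklore] `|C(y′,y)| ≤ c_C`. -/
theorem abs_Csq_le_const (m : ℕ) {a : ℝ} (ha : 0 < a) (y' y : X d) : |Csq m a y' y| ≤ cC d a := by
  refine (abs_Csq_le m ha y' y).trans ?_
  have he : Real.exp (-(deltaC d a * dist y' y)) ≤ 1 := by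
    rw [Real.exp_le_one_iff, neg_nonpos]; exact mul_nonneg (deltaC_pos d ha).le dist_nonneg
  have := cC_pos d ha
  nlinarith

/-- [folklore] `r ↦ (G′Q′*C)(r,y)·P(r,q)` is summable over the fine lattice (block majorant from `abs_kerP_le`, `P` bounded). -/
theorem summable_kerP_mul_Pker (m : ℕ) {a : ℝ} (ha : 0 < a) (y q : X d) :
    Summable fun r : X d => kerP m a r y * Pker m a r q := by
  refine summable_of_blk_majorant m (deltaP_pos d ha) y (C := cP d m a * cPP d m a) fun r => ?_
  rw [abs_mul]
  have h1 := abs_kerP_le m ha r y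
  have h2 := abs_Pker_le_const m ha r q
  have h0 := cP_nonneg d m ha
  calc |kerP m a r y| * |Pker m a r q| ≤ (cP d m a * Real.exp (-(deltaP d a * dist (blk m r) y))) * cPP d m a :=
        mul_le_mul h1 h2 (abs_nonneg _) (by positivity)
    _ = cP d m a * cPP d m a * Real.exp (-(deltaP d a * dist y (blk m r))) := by rw [dist_comm]; ring

/-- [folklore] `p ↦ P(p,q)·(G′Q′*)(p,y′)` is summable (`RProjectorRange.summable_gq_mul_Pker`, commuted). -/
theorem summable_Pker_mul_gq (m : ℕ) {a : ℝ} (ha : 0 < a) (q y' : X d) :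
    Summable fun p : X d => Pker m a p q * gq m a p y' := by
  have h := summable_gq_mul_Pker m ha y' q
  refine h.congr fun p => ?_
  ring

/-- [folklore] **`X⁺ ∘ P = X⁺` ON THE LATTICE**: `Σ'_r (G′Q′*C)(r,y)·P(r,q) = (G′Q′*C)(q,y)`.  Proof: block by block (`tsum_blocks`),
inside a block `sum_mul_kerP`, one Fubini between the block label and the coarse series (`tsum_mul_tsum_comm` under the majorant
`abs_sum_B_Pker_mul_gq_le × c_C`), re-assembly of the fine series and `Q′G′·P = Q′G′` (`tsum_gq_mul_Pker`). -/
theorem tsum_kerP_mul_Pker (m : ℕ) {a : ℝ} (ha : 0 < a) (y q : X d) :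
    ∑' r : X d, kerP m a r y * Pker m a r q = kerP m a q y := by
  classical
  have hδu := deltaU_pos d ha
  have hδPP := deltaPP_pos d ha
  -- (1)+(2) block by block
  rw [← tsum_blocks m (summable_kerP_mul_Pker m ha y q)]
  -- (3) inside each block
  have hblock : ∀ w : X d, ∑ p ∈ B m w, kerP m a p y * Pker m a p q =
      ∑' y' : X d, (∑ p ∈ B m w, Pker m a p q * gq m a p y') * Csq m a y' y := by
    intro w
    rw [← sum_mul_kerP m ha (B m w) (fun p => Pker m a p q) y]
    exact Finset.sum_congr rfl fun p _ => mul_comm _ _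
  simp_rw [hblock]
  -- (4) Fubini between `w` and `y'`
  set K : ℝ := (((m : ℝ) + 1) ^ d * cPP d m a * (cU d a * Real.sqrt (((m : ℝ) + 1) ^ d))) * cC d a with hK
  have hmaj : ∀ w y' : X d, |(1 : ℝ) * ((∑ p ∈ B m w, Pker m a p q * gq m a p y') * Csq m a y' y)|
      ≤ K * Real.exp (-(deltaPP d a * dist (blk m q) w)) * Real.exp (-(deltaU d a * dist w y')) := by
    intro w y'
    rw [one_mul, abs_mul]
    have e : ∑ p ∈ B m w, Pker m a p q * gq m a p y' = ∑ r ∈ B m w, Pker m a q r * gq m a r y' :=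
      Finset.sum_congr rfl fun p _ => by rw [Pker_symm m ha p q]
    rw [e]
    have h1 := abs_sum_B_Pker_mul_gq_le m ha q w y'
    have h2 := abs_Csq_le_const m ha y' y
    have hc := cC_pos d ha
    calc |∑ r ∈ B m w, Pker m a q r * gq m a r y'| * |Csq m a y' y|
        ≤ ((((m : ℝ) + 1) ^ d * cPP d m a * (cU d a * Real.sqrt (((m : ℝ) + 1) ^ d)))
            * Real.exp (-(deltaPP d a * dist (blk m q) w)) * Real.exp (-(deltaU d a * dist w y'))) * cC d a :=
          mul_le_mul h1 h2 (abs_nonneg _) (by have := cPP_nonneg d m ha; have := cU_pos d ha; positivity)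
      _ = _ := by rw [hK]; ring
  have hswap := tsum_mul_tsum_comm (f := fun _ : X d => (1 : ℝ))
    (g := fun w y' => (∑ p ∈ B m w, Pker m a p q * gq m a p y') * Csq m a y' y) hδPP hδu (blk m q) hmaj
  simp only [one_mul] at hswap
  rw [hswap]
  -- (5) inner re-assembly
  have hinner : ∀ y' : X d, ∑' w : X d, (∑ p ∈ B m w, Pker m a p q * gq m a p y') * Csq m a y' y = gq m a q y' * Csq m a y' y := by
    intro y'
    rw [tsum_mul_right, tsum_blocks m (summable_Pker_mul_gq m ha q y')]
    congr 1
    have e : (fun p : X d => Pker m a p q * gq m a p y') = fun p => gq m a p y' * Pker m a p q := funext fun p => mul_comm _ _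
    rw [e, tsum_gq_mul_Pker m ha y' q]
  simp_rw [hinner]
  rfl

end Lattice

section Inputs

variable (n : ℕ) [NeZero n] (a : ℝ) (κ' : Fin 4) (u : Site 4)

omit [NeZero n] in
/-- [folklore] **`P ∘ P = P` as a kernel identity** (`RProjectorRange.tsum_Pgt_mul_Pgt` BY NAME). -/
theorem comp_Pgt_Pgt (ha : 0 < a) : comp (Pgt n a) (Pgt n a) = Pgt n a := by
  funext x y v w
  simp only [comp, Finset.univ_unique, PUnit.default_eq_unit, Finset.sum_singleton]
  exact tsum_Pgt_mul_Pgt n ha x y v w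

omit [NeZero n] in
/-- [folklore] **`Pᵀ = P`** (`RProjector.Pgt_symm` BY NAME). -/
theorem trK_Pgt (ha : 0 < a) : trK (Pgt n a) = Pgt n a := by
  funext x y v w
  rw [trK_apply]
  exact Pgt_symm n ha y x w v

omit [NeZero n] in
/-- [folklore] **`J ∘ P = J`** for the coarse piece of part 1: `comp (Jq n a κ′ u) (Pgt n a) = Jq n a κ′ u` (`tsum_kerP_mul_Pker`). -/
theorem comp_Jq_Pgt (ha : 0 < a) : comp (Jq n a κ' u) (Pgt n a) = Jq n a κ' u := by
  funext s q v w
  simp only [comp, Finset.univ_unique, PUnit.default_eq_unit, Finset.sum_singleton, Jq_apply, Pgt_apply]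
  have e : (fun r : Site 4 => -(qJet n κ' u (blk (n - 1) s) s * kerP (d := 4) (n - 1) a r (blk (n - 1) s)) * Pker (d := 4) (n - 1) a r q)
      = fun r => -qJet n κ' u (blk (n - 1) s) s * (kerP (d := 4) (n - 1) a r (blk (n - 1) s) * Pker (d := 4) (n - 1) a r q) :=
    funext fun r => by ring
  rw [e, tsum_mul_left, tsum_kerP_mul_Pker (n - 1) ha (blk (n - 1) s) q, neg_mul]

/-- [folklore] The stencil is localised. -/
theorem loc_Sgh (cK cQ : ℝ) : Loc (Sgh n cK cQ κ' u) := by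
  have hn : (0 : ℝ) < n := Nat.cast_pos.mpr (Nat.pos_of_ne_zero (NeZero.ne n))
  exact ⟨u, u, _, 1 / (n : ℝ), by positivity, biLoc_Sgh κ' u n cK cQ zero_le_one⟩

/-- [folklore] The coarse piece is localised. -/
theorem loc_Jq (ha : 0 < a) : Loc (Jq n a κ' u) := by
  have hn : (0 : ℝ) < n := Nat.cast_pos.mpr (Nat.pos_of_ne_zero (NeZero.ne n))
  exact ⟨u, u, _, RProjectorJet.dJ a / n, by have := RProjectorJet.dJ_pos a ha; positivity, biLoc_Jq n a κ' u ha⟩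

end Inputs

/-! ## §3 The instance: `Rdot n a cK cQ κ′ u` passes the projector-Leibniz socket on `ℤ⁴` -/

section Instance

variable (n : ℕ) [NeZero n] (a cK cQ : ℝ) (κ' : Fin 4) (u : Site 4)

/-- [folklore] **`P ∘ Ṙ_s + Ṙ_s ∘ P = Ṙ_s`** for the typed jet — GIVEN the fine `ℓ¹` decay of the projector (binder `hP`, `0 < δP`;
leaf-05-g3's `decays_Pgt` — used only for absolute-convergence bookkeeping). -/
theorem leibniz_P_Rdot (ha : 0 < a) {CP δP : ℝ} (hδP : 0 < δP) (hP : Decays (Pgt n a) CP δP) :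
    comp (Pgt n a) (Rdot n a cK cQ κ' u) + comp (Rdot n a cK cQ κ' u) (Pgt n a) = Rdot n a cK cQ κ' u :=
  leibniz_P (spr_Ggh n a ha) ⟨CP, δP, hδP, hP⟩ (loc_Sgh n κ' u cK cQ) (loc_Jq n a κ' u ha) (comp_Pgt_Pgt n a ha) (trK_Pgt n a ha)
    (comp_Jq_Pgt n a κ' u ha)

/-- [folklore] **`R ∘ Ṙ_s + Ṙ_s ∘ R = Ṙ_s`**, `R = idK − Pgt n a` (the first identity of `ProjectorJetStripped.eq_cojetSkew_iff`, on the lattice). -/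
theorem leibniz_R_Rdot (ha : 0 < a) {CP δP : ℝ} (hδP : 0 < δP) (hP : Decays (Pgt n a) CP δP) :
    comp (idK - Pgt n a) (Rdot n a cK cQ κ' u) + comp (Rdot n a cK cQ κ' u) (idK - Pgt n a) = Rdot n a cK cQ κ' u :=
  leibniz_R (spr_Ggh n a ha) ⟨CP, δP, hδP, hP⟩ (loc_Sgh n κ' u cK cQ) (loc_Jq n a κ' u ha) (comp_Pgt_Pgt n a ha) (trK_Pgt n a ha)
    (comp_Jq_Pgt n a κ' u ha)

/-- [folklore] **`P ∘ Ṙ_s ∘ P = 0`**. -/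
theorem Pgt_Rdot_Pgt (ha : 0 < a) {CP δP : ℝ} (hδP : 0 < δP) (hP : Decays (Pgt n a) CP δP) :
    comp (comp (Pgt n a) (Rdot n a cK cQ κ' u)) (Pgt n a) = 0 :=
  P_rdot_P (spr_Ggh n a ha) ⟨CP, δP, hδP, hP⟩ (loc_Sgh n κ' u cK cQ) (loc_Jq n a κ' u ha) (comp_Pgt_Pgt n a ha) (trK_Pgt n a ha)
    (comp_Jq_Pgt n a κ' u ha)

/-- [folklore] **`R ∘ Ṙ_s ∘ R = 0`**, `R = idK − Pgt n a`. -/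
theorem R_Rdot_R (ha : 0 < a) {CP δP : ℝ} (hδP : 0 < δP) (hP : Decays (Pgt n a) CP δP) :
    comp (comp (idK - Pgt n a) (Rdot n a cK cQ κ' u)) (idK - Pgt n a) = 0 :=
  R_rdot_R (spr_Ggh n a ha) ⟨CP, δP, hδP, hP⟩ (loc_Sgh n κ' u cK cQ) (loc_Jq n a κ' u ha) (comp_Pgt_Pgt n a ha) (trK_Pgt n a ha)
    (comp_Jq_Pgt n a κ' u ha)

end Instance

end

end Summit.QuantumFields.BalabanUV.Beta.D1BFx.RProjectorJetLeibniz
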